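import Mathlib
import HarnessLib

/-!
# The tower step, surface form: a stable plane other than the hyperplane meets it in a stable line (Phase 0 tower analysis, crux `WildQuotients.WildQuotientResolution`)

Crux stmt-ResolutionOfSingularities-15640 (`WildQuotientResolution`), registered stub
`stub_phaseZeroHighDim`, move-game track. Linear core of the SURFACE CASE (g4) of the tower
analysis (memo `PHASE0-DIM3-TERMINATION.md` §2(g), addendum (R7)): at a storey of a constant-inertia
tower on a threefold, `V = T_z X` is 3-dimensional, `A = T_z E` is the stable hyperplane WITHOUT
stable lines (✓`StableLinePClosed`, ✓`TowerStep`), and an `I`-stable regular surface `S` through `z`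
has an `I`-stable tangent PLANE `P = T_z S`. If `P ≠ A` then `P ∩ A` is an `I`-stable LINE inside
`A` — impossible. Hence **every stable regular surface through a (late) tower point is tangent to
the exceptional divisor** and cannot contain the transversal branch of the tower: the surface case
(g4) is contradictory once the strict transform is regular at the tower point.

* `finrank_inf_eq_one_of_ne` — two distinct planes in a 3-space meet in a line.
* `inf_stable` — the intersection of stable subspaces is stable (bookkeeping).
* `eq_of_stable_plane_of_no_stable_line` — a stable plane is the hyperplane `A` if `A` has no
  stable line.

[OURS · crux stmt-ResolutionOfSingularities-15640 · helper toward `stub_phaseZeroHighDim`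
(termination of the point-move towers, dim 3, surface case); folklore linear algebra, counted 0;
AI-level work, weaker than expert review.]
-/

-- single-problem summit: the doubled namespace component `ResolutionOfSingularities` is forced
set_option linter.dupNamespace false

namespace Summit.ResolutionOfSingularities.ResolutionOfSingularities.Theorems.WildQuotientResolution.TowerStep

variable {K : Type*} [DivisionRing K] {V : Type*} [AddCommGroup V] [Module K V]

/-- **Two distinct planes in a 3-space meet in a line.** [folklore] -/
theorem finrank_inf_eq_one_of_ne [FiniteDimensional K V] (h3 : Module.finrank K V = 3)
    (A P : Submodule K V) (hA : Module.finrank K A = 2) (hP : Module.finrank K P = 2)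
    (hne : P ≠ A) : Module.finrank K ↥(P ⊓ A) = 1 := by
  -- `P ⊔ A = ⊤`: otherwise `P ⊔ A` has dimension `2` and equals both `P` and `A`
  have hsum := Submodule.finrank_sup_add_finrank_inf_eq P A
  rw [hP, hA] at hsum
  have hsup_le : Module.finrank K ↥(P ⊔ A) ≤ 3 := h3 ▸ Submodule.finrank_le (P ⊔ A)
  have hsup_ge : 2 ≤ Module.finrank K ↥(P ⊔ A) := hP ▸ Submodule.finrank_mono le_sup_left
  by_contra hinf
  -- then `finrank (P ⊔ A) = 2` would force `P = P ⊔ A = A`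
  have hsup2 : Module.finrank K ↥(P ⊔ A) = 2 := by omega
  have hPeq : P = P ⊔ A :=
    Submodule.eq_of_le_of_finrank_eq le_sup_left (by rw [hP, hsup2])
  have hAeq : A = P ⊔ A :=
    Submodule.eq_of_le_of_finrank_eq le_sup_right (by rw [hA, hsup2])
  exact hne (hPeq.trans hAeq.symm)

/-- The intersection of two subspaces stable under a linear map is stable. [folklore] -/
theorem inf_stable (f : V →ₗ[K] V) (A P : Submodule K V) (hA : A ≤ A.comap f)
    (hP : P ≤ P.comap f) : P ⊓ A ≤ (P ⊓ A).comap f := by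
  intro v hv
  exact ⟨hP hv.1, hA hv.2⟩

/-- **A stable plane is the hyperplane without stable lines.** In a 3-dimensional `V` let `A` be
a plane containing no line stable under the endomorphisms `f i`, and `P` a plane stable under all
`f i`, with `A` stable too. Then `P = A`. (Surface case of the tower analysis: the tangent plane of
a stable regular surface through a late tower point is the tangent plane of the exceptional
divisor.) [folklore] -/
theorem eq_of_stable_plane_of_no_stable_line [FiniteDimensional K V] {ι : Type*}
    (f : ι → V →ₗ[K] V) (h3 : Module.finrank K V = 3) (A P : Submodule K V)
    (hA : Module.finrank K A = 2) (hP : Module.finrank K P = 2)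
    (hAs : ∀ i, A ≤ A.comap (f i)) (hPs : ∀ i, P ≤ P.comap (f i))
    (hW : ∀ L' : Submodule K V, L' ≤ A → Module.finrank K L' = 1 →
      ¬ ∀ i, L' ≤ L'.comap (f i)) : P = A := by
  by_contra hne
  exact hW (P ⊓ A) inf_le_right (finrank_inf_eq_one_of_ne h3 A P hA hP hne)
    fun i => inf_stable (f i) A P (hAs i) (hPs i)

end Summit.ResolutionOfSingularities.ResolutionOfSingularities.Theorems.WildQuotientResolution.TowerStep
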